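import Mathlib
import Summits.Ventures.PercRepro2.Independence
import Summits.Ventures.PercRepro2.Harris
import Summits.Ventures.PercRepro2.HCov
import Summits.Ventures.PercRepro2.CutVertexPaths
import Summits.Ventures.PercRepro2.CutOneFarConn
import Summits.Ventures.PercRepro2.CutTwoFarConn
import Summits.Ventures.PercRepro2.CutTwoFarLaw
import Summits.Ventures.PercRepro2.CutTwoFar
import Summits.Ventures.PercRepro2.CutTwoFarHarris
import Summits.Ventures.PercRepro2.CutTwoFarRootsLaw
import Summits.Ventures.PercRepro2.CutTwoFarRightPat
import Summits.Ventures.PercRepro2.CutTwoFarROConn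
import Summits.Ventures.PercRepro2.CutTwoFarROMasses

/-!
# A root and `o` behind a cut vertex, III: THE FOUR-ENDPOINT REDUCTION (blind cell PercRepro2,
typer-1 g50)

The reduction of MINE2-CUTVERTEX.md §13.2 / §13.8 for the class T6 (S3.5, the role pair `{a₁, o}`)
in the kernel: with `v` a cut vertex, `a₁, o` on the left and `a₂, a₃, b` on the right (or at `v`),

  `Gc = δ · ((1 − P) γₒ(0) + P γₒ(1)) + q_x · P · ((1 − P) hₒ(0) + P hₒ(1))`

(**`Gc_a1oFar_eq`**), with `P = P_A(a₁ ↔ v) = q_all + q_x1`, `q_x = P_A(o ↔ v, a₁ ↮ v) = q_x2`,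
`δ = q_all − (q_all + q_x1)(q_all + q_12) ≥ 0` (Harris on the part, `harris_x1_12`), and the FOUR
ENDPOINT NUMBERS `γₒ(0), γₒ(1), hₒ(0), hₒ(1)` of §13.8 — explicit right-side quantities (`γₒ(0) =
2 n₃ [α_b − β_b + b_b · P(v ↮ a₂, a₃ ↮ v)]`, …).  Hence (HCOV) on the class whenever the four endpoint
numbers are nonnegative (**`HCov_a1oFar_of_endpoints`**) — mine-2's reduction of the root-far
classes to «four B-side numbers ≥ 0» (three of them theorems by Harris / BHK on paper, `γₒ(1)` by
lemma (L6) = `RootLeafO`), here as an exact identity for every weight vector.  Proof: the bilinear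
forms of Part II, `∑ q = 1`, `∑ r = 1`, and `ring`.  Own work; standard axioms.
-/

namespace Summit.Ventures.PercRepro2

open CovForm CutVertexM9 UnionCluster

namespace CutTwoFar

section ROFar

variable {V : Type*} {E : Type*} [Fintype E] [DecidableEq E] {R : Type*} [Field R]
variable {ends : E → Sym2 V} {side : E → Bool} {L : Set V} {v : V} {Rt : Set V}

variable (h : CutVertex ends side L v Rt) {o b a₁ a₂ a₃ : V} (p : E → R)
include h

/-- **The T6 reduction** (MINE2-CUTVERTEX §13.8): with `a₁, o` behind the cut vertex `v`,
`Gc = δ · ((1 − P) γₒ(0) + P γₒ(1)) + q_x2 · P · ((1 − P) hₒ(0) + P hₒ(1))`. -/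
theorem Gc_a1oFar_eq (h1 : a₁ ∈ L ∨ a₁ = v) (ho : o ∈ L ∨ o = v) (h2 : a₂ ∈ Rt ∨ a₂ = v)
    (h3 : a₃ ∈ Rt ∨ a₃ = v) (hb : b ∈ Rt ∨ b = v) : Gc p ends o a₁ a₂ a₃ b =
    (patProb ends side v a₁ o p ![true, true, true] - (patProb ends side v a₁ o p ![true, true, true] + patProb ends side v a₁ o p ![true, false, false]) * (patProb ends side v a₁ o p ![true, true, true] + patProb ends side v a₁ o p ![false, false, true])) * ((1 - (patProb ends side v a₁ o p ![true, true, true] + patProb ends side v a₁ o p ![true, false, false])) * (2 * prob p {ω | ¬ Conn ends ω a₃ a₂} * (prob p {ω | ¬ Conn ends ω v a₂ ∧ Conn ends ω b v ∧ Conn ends ω a₃ a₂} - prob p {ω | ¬ Conn ends ω v a₂ ∧ Conn ends ω b a₂ ∧ ¬ Conn ends ω a₃ v} + prob p {ω | Conn ends ω b a₂} * prob p {ω | ¬ Conn ends ω v a₂ ∧ ¬ Conn ends ω a₃ v})) + (patProb ends side v a₁ o p ![true, true, true] + patProb ends side v a₁ o p ![true, false, false]) * (2 * (prob p {ω | ¬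 Conn ends ω v a₂} * prob p {ω | ¬ Conn ends ω v a₂ ∧ ¬ (Conn ends ω a₃ v ∨ Conn ends ω a₃ a₂)} * prob p {ω | Conn ends ω b a₂} + prob p {ω | ¬ Conn ends ω a₃ a₂} * prob p {ω | ¬ Conn ends ω v a₂} * (prob p {ω | ¬ Conn ends ω v a₂ ∧ Conn ends ω b v ∧ Conn ends ω a₃ a₂} - prob p {ω | ¬ Conn ends ω v a₂ ∧ Conn ends ω b a₂ ∧ ¬ Conn ends ω a₃ v}) + (prob p {ω | ¬ Conn ends ω v a₂ ∧ Conn ends ω b v} - prob p {ω | ¬ Conn ends ω v a₂ ∧ Conn ends ω b a₂}) * (prob p {ω | ¬ Conn ends ω v a₂ ∧ ¬ (Conn ends ω a₃ v ∨ Conn ends ω a₃ a₂)} * prob p {ω | Conn ends ω a₃ a₂} - prob p {ω | ¬ Conn ends ω a₃ a₂} * prob p {ω | ¬ Conn ends ω v a₂ ∧ Conn ends ω a₃ a₂})))) +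
      patProb ends side v a₁ o p ![false, true, false] * (patProb ends side v a₁ o p ![true, true, true] + patProb ends side v a₁ o p ![true, false, false]) * ((1 - (patProb ends side v a₁ o p ![true, true, true] + patProb ends side v a₁ o p ![true, false, false])) * (2 * prob p {ω | Conn ends ω v a₂ ∧ ¬ Conn ends ω a₃ a₂} * (prob p {ω | ¬ Conn ends ω v a₂ ∧ Conn ends ω b v ∧ ¬ Conn ends ω a₃ a₂} + (prob p {ω | Conn ends ω b a₂} * prob p {ω | ¬ Conn ends ω v a₂ ∧ Conn ends ω a₃ v} - prob p {ω | ¬ Conn ends ω v a₂ ∧ Conn ends ω b a₂ ∧ Conn ends ω a₃ v}))) + (patProb ends side v a₁ o p ![true, true, true] + patProb ends side v a₁ o p ![true, false, false]) * (2 * prob p {ω | Conn ends ω v a₂ ∧ ¬ Conn ends ω a₃ a₂} * (-(prob p {ω | ¬ Conn ends ω v a₂} * prob p {ω | ¬ Conn ends ω v a₂ ∧ Conn ends ω b a₂ ∧ Conn ends ω a₃ v} - prob p {ω | ¬ Conn ends ω v a₂ ∧ Conn ends ω b a₂} * prob p {ω | ¬ Conn ends ω v a₂ ∧ Conn ends ω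 a₃ v}) - (prob p {ω | ¬ Conn ends ω v a₂} * prob p {ω | ¬ Conn ends ω v a₂ ∧ Conn ends ω b v ∧ Conn ends ω a₃ a₂} - prob p {ω | ¬ Conn ends ω v a₂ ∧ Conn ends ω b v} * prob p {ω | ¬ Conn ends ω v a₂ ∧ Conn ends ω a₃ a₂}) + prob p {ω | ¬ Conn ends ω v a₂ ∧ Conn ends ω b v} * prob p {ω | ¬ Conn ends ω v a₂ ∧ ¬ (Conn ends ω a₃ v ∨ Conn ends ω a₃ a₂)}))) := by
  have hq := sum_patProb_transPatterns ends side v a₁ o p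
  rw [sum_transPatterns] at hq
  have hr := ratom_sum_transSix ends side v a₂ a₃ b p
  rw [sum_transSix] at hr
  have hqs : patProb ends side v a₁ o p ![false, false, false] = 1 - (patProb ends side v a₁ o p ![true, true, true] + patProb ends side v a₁ o p ![true, false, false] + patProb ends side v a₁ o p ![false, true, false] + patProb ends side v a₁ o p ![false, false, true]) := by
    linear_combination hq
  have hrs : ratom ends side v a₂ a₃ b p ![false, false, false, false, false, false] = 1 - (ratom ends side v a₂ a₃ b p ![true, true, true, true, true, true] + ratom ends side v a₂ a₃ b p ![true, true, false, true, false, false] + ratom ends side v a₂ a₃ b p ![true, false, true, false, true, false] + ratom ends side v a₂ a₃ b p ![true, false, false, false, false, true] + ratom ends side v a₂ a₃ b p ![true, false, false, false, false, false] + ratom ends side v a₂ a₃ b p ![false, true, true, false, false, true] + ratom ends side v a₂ a₃ b p ![false, true, false, false, true, false] + ratom ends side v a₂ a₃ b p ![false, true, false, false, false, false] + ratom ends side v a₂ a₃ b p ![false, false, true, true, false, false] + ratom ends side v a₂ a₃ b p ![false, false, true, false, false, false] + ratom ends side v a₂ a₃ b p ![false, false, false, true, true, true] + ratom ends side v a₂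 a₃ b p ![false, false, false, true, false, false] + ratom ends side v a₂ a₃ b p ![false, false, false, false, true, false] + ratom ends side v a₂ a₃ b p ![false, false, false, false, false, true]) := by
    linear_combination hr
  simp only [Gc, DEF]
  rw [PQ_ro h p h1 h2,
    D_ro h p h1 h2 h3,
    Do_ro h p h1 ho h2 h3,
    EQbo_ro h p h1 ho h2 hb,
    EQb3_ro h p h1 h2 h3 hb,
    EQb3o_ro h p h1 ho h2 h3 hb,
    gap_ro h p h1 h2 hb,
    EQo_ro h p h1 ho h2,
    EQ3_ro h p h1 h2 h3,
    EQ3o_ro h p h1 ho h2 h3,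
    PDb_ro h p h1 h2 h3 hb,
    PDbo_ro h p h1 ho h2 h3 hb,
    eo_n3 h p h2 h3,
    eo_PQp h p h2,
    eo_bb h p h2 hb,
    eo_b3 h p h2 h3,
    eo_alphab h p h2 h3 hb,
    eo_betab h p h2 h3 hb,
    eo_xn3n h p h2 h3,
    eo_Dp h p h2 h3,
    eo_QbL h p h2 hb,
    eo_QbH h p h2 hb,
    eo_pi h p h2 h3,
    eo_n3x h p h2 h3,
    eo_bL3nH h p h2 h3 hb,
    eo_3L h p h2 h3,
    eo_bH3L h p h2 h3 hb, hqs, hrs]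
  ring

/-- **(HCOV) with a root and `o` behind a cut vertex, from the four endpoint numbers**. -/
theorem HCov_a1oFar_of_endpoints [LinearOrder R] [IsStrictOrderedRing R] (h1 : a₁ ∈ L ∨ a₁ = v)
    (ho : o ∈ L ∨ o = v) (h2 : a₂ ∈ Rt ∨ a₂ = v) (h3 : a₃ ∈ Rt ∨ a₃ = v) (hb : b ∈ Rt ∨ b = v)
    (hp : IsProbVec p) (hg0 : 0 ≤ 2 * prob p {ω | ¬ Conn ends ω a₃ a₂} * (prob p {ω | ¬ Conn ends ω v a₂ ∧ Conn ends ω b v ∧ Conn ends ω a₃ a₂} - prob p {ω | ¬ Conn ends ω v a₂ ∧ Conn ends ω b a₂ ∧ ¬ Conn ends ω a₃ v} + prob p {ω | Conn ends ω b a₂} * prob p {ω | ¬ Conn ends ω v a₂ ∧ ¬ Conn ends ω a₃ v})) (hg1 : 0 ≤ 2 * (prob p {ω | ¬ Conn ends ω v a₂} * prob p {ω | ¬ Conn ends ω v a₂ ∧ ¬ (Conn ends ω a₃ v ∨ Conn ends ω a₃ a₂)} * prob p {ω | Conn ends ω b a₂} + prob p {ω | ¬ Conn ends ω a₃ a₂}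 * prob p {ω | ¬ Conn ends ω v a₂} * (prob p {ω | ¬ Conn ends ω v a₂ ∧ Conn ends ω b v ∧ Conn ends ω a₃ a₂} - prob p {ω | ¬ Conn ends ω v a₂ ∧ Conn ends ω b a₂ ∧ ¬ Conn ends ω a₃ v}) + (prob p {ω | ¬ Conn ends ω v a₂ ∧ Conn ends ω b v} - prob p {ω | ¬ Conn ends ω v a₂ ∧ Conn ends ω b a₂}) * (prob p {ω | ¬ Conn ends ω v a₂ ∧ ¬ (Conn ends ω a₃ v ∨ Conn ends ω a₃ a₂)} * prob p {ω | Conn ends ω a₃ a₂} - prob p {ω | ¬ Conn ends ω a₃ a₂} * prob p {ω | ¬ Conn ends ω v a₂ ∧ Conn ends ω a₃ a₂}))) (hh0 : 0 ≤ 2 * prob p {ω | Conn ends ω v a₂ ∧ ¬ Conn ends ω a₃ a₂} * (prob p {ω | ¬ Conn ends ω v a₂ ∧ Conn ends ω b v ∧ ¬ Conn ends ω a₃ a₂} + (prob p {ω | Conn ends ω b a₂} * prob p {ω | ¬ Conn ends ω v a₂ ∧ Conn ends ω a₃ v} - prob p {ω | ¬ Conn ends ω v a₂ ∧ Conn ends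 ω b a₂ ∧ Conn ends ω a₃ v}))) (hh1 : 0 ≤ 2 * prob p {ω | Conn ends ω v a₂ ∧ ¬ Conn ends ω a₃ a₂} * (-(prob p {ω | ¬ Conn ends ω v a₂} * prob p {ω | ¬ Conn ends ω v a₂ ∧ Conn ends ω b a₂ ∧ Conn ends ω a₃ v} - prob p {ω | ¬ Conn ends ω v a₂ ∧ Conn ends ω b a₂} * prob p {ω | ¬ Conn ends ω v a₂ ∧ Conn ends ω a₃ v}) - (prob p {ω | ¬ Conn ends ω v a₂} * prob p {ω | ¬ Conn ends ω v a₂ ∧ Conn ends ω b v ∧ Conn ends ω a₃ a₂} - prob p {ω | ¬ Conn ends ω v a₂ ∧ Conn ends ω b v} * prob p {ω | ¬ Conn ends ω v a₂ ∧ Conn ends ω a₃ a₂}) + prob p {ω | ¬ Conn ends ω v a₂ ∧ Conn ends ω b v} * prob p {ω | ¬ Conn ends ω v a₂ ∧ ¬ (Conn ends ω a₃ v ∨ Conn ends ω a₃ a₂)})) :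
    HCov p ends o a₁ a₂ a₃ b := by
  unfold HCov
  rw [Gc_a1oFar_eq h p h1 ho h2 h3 hb]
  have hq : ∀ τ, 0 ≤ patProb ends side v a₁ o p τ := fun τ => prob_nonneg hp _
  have hP1 : (patProb ends side v a₁ o p ![true, true, true] + patProb ends side v a₁ o p ![true, false, false]) ≤ 1 := by
    rw [← prob_L₁_eq]
    exact prob_le_one hp _
  have hδ := harris_x1_12 ends side v a₁ o hp
  exact add_nonneg (mul_nonneg (sub_nonneg.2 hδ) (add_nonneg (mul_nonneg (sub_nonneg.2 hP1) hg0)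
      (mul_nonneg (add_nonneg (hq _) (hq _)) hg1)))
    (mul_nonneg (mul_nonneg (hq _) (add_nonneg (hq _) (hq _)))
      (add_nonneg (mul_nonneg (sub_nonneg.2 hP1) hh0) (mul_nonneg (add_nonneg (hq _) (hq _)) hh1)))

end ROFar

end CutTwoFar

end Summit.Ventures.PercRepro2
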